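import Mathlib
import Summits.ResolutionOfSingularities.ResolutionOfSingularities.Theorems.SyzygyFlatteningDefs
import HarnessLib

/-!
# `stub_detLemmas` — three determinant identities for the surface step

Stub `stub_detLemmas` of the crux `RankOneTermination` (crux stmt-ResolutionOfSingularities-17044,
line `birth`). Pure Mathlib linear algebra over a field `K`:

* (A) if every entry of `M : Matrix (Fin r) (Fin r) K` divided by `x` lies in a subring `S`, then
  `det M / x ^ r ∈ S`: `det M * (x ^ r)⁻¹ = det (x⁻¹ • M)` (`Matrix.det_smul`), and `x⁻¹ • M` is
  the image under `S.subtype.mapMatrix` of a matrix with entries in `S`, whose determinant is in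
  `S` (`RingHom.map_det`);
* (B) the scalar matrix `x · 1` (written entrywise `if j = i then x else 0`) has determinant `x ^ r`
  (`Matrix.det_diagonal`);
* (C) the "arrow" matrix whose row `i` is `x · eᵢ` and whose row `a ≠ i` is `y · eₐ + c a · eᵢ`
  has determinant `x * y ^ r`: Laplace expansion along row `i` (`Matrix.det_succ_row`) leaves the
  single cofactor at `(i, i)`, which is the scalar matrix `y · 1` of size `r`.
-/

noncomputable section

-- single-problem summit: the doubled namespace component `ResolutionOfSingularities` is forced
set_option linter.dupNamespace false

namespace Summit.ResolutionOfSingularities.ResolutionOfSingularities.Theorems.SyzygyFlattening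

/-! ## Part A — determinants with entries divisible by `x` -/

/-- A square matrix over a field all of whose entries lie in a subring `S` has its determinant
in `S` (the determinant is a polynomial in the entries; formally `RingHom.map_det` for
`S.subtype`). [folklore] -/
theorem detLemmas_det_mem_of_forall_mem {K : Type} [Field K] {r : ℕ} (S : Subring K)
    (N : Matrix (Fin r) (Fin r) K) (hN : ∀ i j, N i j ∈ S) : N.det ∈ S := by
  set N' : Matrix (Fin r) (Fin r) S := Matrix.of fun i j => ⟨N i j, hN i j⟩ with hN'
  have h : S.subtype.mapMatrix N' = N := by
    ext i j
    simp [hN']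
  rw [← h, ← RingHom.map_det]
  exact SetLike.coe_mem _

/-- **Part A.** If `x ≠ 0` and every entry `M i j * x⁻¹` lies in the subring `S`, then
`det M * (x ^ r)⁻¹ ∈ S`: indeed `det M * (x ^ r)⁻¹ = det (x⁻¹ • M)` by `Matrix.det_smul`, and the
entries of `x⁻¹ • M` lie in `S`. [folklore] -/
theorem detLemmas_det_mul_inv_pow_mem {K : Type} [Field K] (r : ℕ) (S : Subring K)
    (M : Matrix (Fin r) (Fin r) K) (x : K) (_hx : x ≠ 0) (hM : ∀ i j, M i j * x⁻¹ ∈ S) :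
    M.det * (x ^ r)⁻¹ ∈ S := by
  have h : M.det * (x ^ r)⁻¹ = (x⁻¹ • M).det := by
    rw [Matrix.det_smul, Fintype.card_fin, inv_pow, mul_comm]
  rw [h]
  refine detLemmas_det_mem_of_forall_mem S (x⁻¹ • M) fun i j => ?_
  rw [Matrix.smul_apply, smul_eq_mul, mul_comm]
  exact hM i j

/-! ## Part B — the scalar matrix -/

/-- The entrywise description `if j = i then x else 0` is the scalar (diagonal) matrix
`Matrix.diagonal fun _ => x`. [folklore] -/
theorem detLemmas_of_ite_eq_diagonal {K : Type} [Field K] (r : ℕ) (x : K) :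
    (Matrix.of fun i j : Fin r => if j = i then x else 0) = Matrix.diagonal fun _ => x := by
  ext i j
  rcases eq_or_ne i j with rfl | h
  · simp
  · simp [Matrix.diagonal_apply_ne _ h, h.symm]

/-- **Part B.** The scalar matrix `x · 1` of size `r` has determinant `x ^ r`. [folklore] -/
theorem detLemmas_det_scalar {K : Type} [Field K] (r : ℕ) (x : K) :
    (Matrix.of fun i j : Fin r => if j = i then x else 0).det = x ^ r := by
  rw [detLemmas_of_ite_eq_diagonal, Matrix.det_diagonal, Finset.prod_const, Finset.card_univ,
    Fintype.card_fin]

/-! ## Part C — the arrow matrix -/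

/-- Deleting row and column `i` from the arrow matrix leaves the scalar matrix `y · 1` of size `r`.
[folklore] -/
theorem detLemmas_arrow_submatrix {K : Type} [Field K] (r : ℕ) (i : Fin (r + 1)) (x y : K)
    (c : Fin (r + 1) → K) :
    (Matrix.of fun a b : Fin (r + 1) =>
        if a = i then (if b = i then x else 0)
        else (if b = a then y else if b = i then c a else 0)).submatrix i.succAbove i.succAbove =
      Matrix.diagonal fun _ => y := by
  ext a b
  simp only [Matrix.submatrix_apply, Matrix.of_apply, Fin.succAbove_ne, if_false,
    Fin.succAbove_right_inj]
  rcases eq_or_ne a b with rfl | h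
  · simp
  · simp [Matrix.diagonal_apply_ne _ h, h.symm]

/-- **Part C.** The arrow matrix whose row `i` is `x · eᵢ` and whose row `a ≠ i` is
`y · eₐ + c a · eᵢ` has determinant `x * y ^ r` (Laplace expansion along row `i`). [folklore] -/
theorem detLemmas_det_arrow {K : Type} [Field K] (r : ℕ) (i : Fin (r + 1)) (x y : K)
    (c : Fin (r + 1) → K) :
    (Matrix.of fun a b : Fin (r + 1) =>
        if a = i then (if b = i then x else 0)
        else (if b = a then y else if b = i then c a else 0)).det = x * y ^ r := by
  rw [Matrix.det_succ_row _ i, Finset.sum_eq_single i]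
  · rw [detLemmas_arrow_submatrix, Matrix.det_diagonal, Finset.prod_const, Finset.card_univ,
      Fintype.card_fin]
    simp only [Matrix.of_apply, if_true]
    rw [← two_mul, pow_mul, neg_one_sq, one_pow, one_mul]
  · intro j _ hj
    simp [hj]
  · intro h
    exact absurd (Finset.mem_univ i) h

/-! ## The stub -/

/-- **STUB `stub_detLemmas`** (three determinant identities over a field `K`):
(A) if every entry of `M` divided by `x ≠ 0` lies in a subring `S`, so does `det M / x ^ r`;
(B) `det (x · 1) = x ^ r`;
(C) the arrow matrix (row `i` equal to `x · eᵢ`, row `a ≠ i` equal to `y · eₐ + c a · eᵢ`) has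
determinant `x * y ^ r`. [folklore] -/
theorem stub_detLemmas : ∀ (K : Type) [Field K],
    (∀ (r : ℕ) (S : Subring K) (M : Matrix (Fin r) (Fin r) K) (x : K), x ≠ 0 →
        (∀ i j, M i j * x⁻¹ ∈ S) → M.det * (x ^ r)⁻¹ ∈ S) ∧
    (∀ (r : ℕ) (x : K), (Matrix.of fun i j : Fin r => if j = i then x else 0).det = x ^ r) ∧
    (∀ (r : ℕ) (i : Fin (r + 1)) (x y : K) (c : Fin (r + 1) → K),
        (Matrix.of fun a b : Fin (r + 1) =>
            if a = i then (if b = i then x else 0)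
            else (if b = a then y else if b = i then c a else 0)).det = x * y ^ r) :=
  fun _ _ => ⟨detLemmas_det_mul_inv_pow_mem, detLemmas_det_scalar, detLemmas_det_arrow⟩

end Summit.ResolutionOfSingularities.ResolutionOfSingularities.Theorems.SyzygyFlattening

end
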